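import Summits.CriticalPhenomena.PercolationContinuityZ3.Theorems.PercNearOneGluingNoHeavyLowerTailWorstFirstGluing
import HarnessLib

/-!
# `NoHeavyLowerTail` (stmt-CriticalPhenomena-4575) — WORST-FIRST GLUING holds for two relays

Support file (prover prim-gen-kcluster gen 2; `--supports stmt-CriticalPhenomena-4575`).  No definitions, no sorries.
Companion of `…WorstFirstGluing.lean` (the decomposition and `(WF) ⇒ event gluing ⇒ AdditiveGluing / NoHeavyLowerTail`).

* `worstFirst_two_mul` (PROVED): for distinct relays `a₁, a₂` with `μ(a₂ ↮ c) ≤ μ(a₁ ↮ c)`,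
  `μ(a₁ ↮ c) · μ(o ↔ a₂, o ↮ a₁, o ↮ c) ≤ μ(a₂ ↮ c) · μ(o ↮ a₁, a₁ ↮ c)`.
  Proof (new): with `T_1 = μ(o↮a₁, a₁↮c)`, `S_1 = μ(o↔a₂, o↮a₁, o↮c)`, `S_2 = μ(o↔a₁, o↮a₂, o↮c)`, `T_2 = μ(o↮a₂, a₂↮c)`,
  `J = μ(o↔a₁, o↔a₂, o↮c)` one has `d_1 = T_1 + S_2 + J`, `d_2 = T_2 + S_1 + J` (`disconnection_split₃`), so
  `d_2 T_1 − d_1 S_1 = (T_1T_2 − S_1S_2) + J(T_1 − S_1)`; the first bracket is the tripod exchange C⁺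
  (`worstPairExchange_two`, BHK 2006 Thm 1.5), the second is event gluing for two relays at the worse relay.
* `worstFirst_card_le_two`: the worst-first gluing inequality `Σ_{a∈A} μ(W_a)/μ(a ↮ c) ≤ 1` in the exact form of the
  hypothesis of `eventGluing_of_worstFirst`, for every relay set with `|A| ≤ 2`.
-/

noncomputable section

namespace Summit.CriticalPhenomena.PercolationContinuityZ3.Theorems

open MeasureTheory Set Literature.Probability.LatticeModels Literature.Probability.Percolation
open Summit.CriticalPhenomena.PercolationContinuityZ3.Theses.PercNearOneGluing
open scoped Classical BigOperators

namespace WorstFirstGluing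

variable {n : ℕ}

/-- `μ(E ∩ F) + μ(E ∩ Fᶜ) = μ(E)` for the (finite, discrete) percolation measure. [folklore] -/
theorem real_inter_add_inter_compl (w : Sym2 (Fin n) → unitInterval) (E F : Set (BondConfig (Fin n))) :
    (prodBernoulli w).real (E ∩ F) + (prodBernoulli w).real (E ∩ Fᶜ) = (prodBernoulli w).real E := by
  rw [← Set.sdiff_eq]
  exact measureReal_inter_add_sdiff MeasurableSet.of_discrete

/-- `d_{a₁} = T_1 + S_2 + J`: `μ(a₁ ↮ c) = μ(o ↮ a₁, a₁ ↮ c) + μ(o ↔ a₁, o ↮ a₂, o ↮ c) + μ(o ↔ a₁, o ↔ a₂, o ↮ c)`.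
[folklore] -/
theorem disconnection_split₃ (w : Sym2 (Fin n) → unitInterval) (o c a₁ a₂ : Fin n) :
    (prodBernoulli w).real (openConn a₁ c : Set (BondConfig (Fin n)))ᶜ =
      (prodBernoulli w).real ((openConn o a₁ : Set (BondConfig (Fin n)))ᶜ ∩ (openConn a₁ c)ᶜ) +
        (prodBernoulli w).real ((openConn o a₂ : Set (BondConfig (Fin n)))ᶜ ∩ (openConn o c)ᶜ ∩ openConn o a₁) +
          (prodBernoulli w).real ((openConn o a₁ : Set (BondConfig (Fin n))) ∩ openConn o a₂ ∩ (openConn o c)ᶜ) := by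
  set μ := prodBernoulli w with hμ
  have h1 := WorstPairExchange.split_disconnection w o c a₁
  -- `{o ↔ a₁} ∩ {a₁ ↮ c} = {o ↔ a₁} ∩ {o ↮ c}`
  have hset : ((openConn o a₁ : Set (BondConfig (Fin n))) ∩ (openConn a₁ c)ᶜ) =
      ((openConn o a₁ : Set (BondConfig (Fin n))) ∩ (openConn o c)ᶜ) := by
    ext ω
    simp only [mem_inter_iff, mem_compl_iff]
    constructor
    · rintro ⟨hoa, hac⟩
      exact ⟨hoa, fun hoc => hac (SimpleGraph.Reachable.trans (SimpleGraph.Reachable.symm hoa) hoc)⟩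
    · rintro ⟨hoa, hoc⟩
      exact ⟨hoa, fun hac => hoc (SimpleGraph.Reachable.trans hoa hac)⟩
  have h2 := real_inter_add_inter_compl w ((openConn o a₁ : Set (BondConfig (Fin n))) ∩ (openConn o c)ᶜ)
    (openConn o a₂ : Set (BondConfig (Fin n)))
  have e1 : ((openConn o a₁ : Set (BondConfig (Fin n))) ∩ (openConn o c)ᶜ ∩ openConn o a₂) =
      ((openConn o a₁ : Set (BondConfig (Fin n))) ∩ openConn o a₂ ∩ (openConn o c)ᶜ) := by
    ext ω; simp only [mem_inter_iff, mem_compl_iff]; tauto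
  have e2 : ((openConn o a₁ : Set (BondConfig (Fin n))) ∩ (openConn o c)ᶜ ∩ (openConn o a₂)ᶜ) =
      ((openConn o a₂ : Set (BondConfig (Fin n)))ᶜ ∩ (openConn o c)ᶜ ∩ openConn o a₁) := by
    ext ω; simp only [mem_inter_iff, mem_compl_iff]; tauto
  rw [e1, e2] at h2
  rw [hset] at h1
  linarith

end WorstFirstGluing

open WorstFirstGluing WorstPairExchange

/-- **Worst-first gluing for two relays, product form (PROVED).**  For distinct relays `a₁, a₂` with
`μ(a₂ ↮ c) ≤ μ(a₁ ↮ c)` (`a₁` is the worse relay):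
`μ(a₁ ↮ c) · μ(o ↔ a₂, o ↮ a₁, o ↮ c) ≤ μ(a₂ ↮ c) · μ(o ↮ a₁, a₁ ↮ c)`.
Proof: `d_2 T_1 − d_1 S_1 = (T_1T_2 − S_1S_2) + J(T_1 − S_1)` with `T_1T_2 ≥ S_1S_2` the tripod exchange
(`worstPairExchange_two`) and `T_1 ≥ S_1` event gluing for two relays at the worse relay. [this file] -/
theorem worstFirst_two_mul {n : ℕ} (w : Sym2 (Fin n) → unitInterval) (o c a₁ a₂ : Fin n) (h12 : a₁ ≠ a₂)
    (hd : (prodBernoulli w).real (openConn a₂ c : Set (BondConfig (Fin n)))ᶜ ≤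
      (prodBernoulli w).real (openConn a₁ c : Set (BondConfig (Fin n)))ᶜ) :
    (prodBernoulli w).real (openConn a₁ c : Set (BondConfig (Fin n)))ᶜ *
        (prodBernoulli w).real ((openConn o a₁ : Set (BondConfig (Fin n)))ᶜ ∩ (openConn o c)ᶜ ∩ openConn o a₂) ≤
      (prodBernoulli w).real (openConn a₂ c : Set (BondConfig (Fin n)))ᶜ *
        (prodBernoulli w).real ((openConn o a₁ : Set (BondConfig (Fin n)))ᶜ ∩ (openConn a₁ c)ᶜ) := by
  set μ := prodBernoulli w with hμ
  set T1 := μ.real ((openConn o a₁ : Set (BondConfig (Fin n)))ᶜ ∩ (openConn a₁ c)ᶜ) with hT1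
  set T2 := μ.real ((openConn o a₂ : Set (BondConfig (Fin n)))ᶜ ∩ (openConn a₂ c)ᶜ) with hT2
  set S1 := μ.real ((openConn o a₁ : Set (BondConfig (Fin n)))ᶜ ∩ (openConn o c)ᶜ ∩ openConn o a₂) with hS1
  set S2 := μ.real ((openConn o a₂ : Set (BondConfig (Fin n)))ᶜ ∩ (openConn o c)ᶜ ∩ openConn o a₁) with hS2
  set J := μ.real ((openConn o a₁ : Set (BondConfig (Fin n))) ∩ openConn o a₂ ∩ (openConn o c)ᶜ) with hJ
  have hd1 : μ.real (openConn a₁ c : Set (BondConfig (Fin n)))ᶜ = T1 + S2 + J := disconnection_split₃ w o c a₁ a₂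
  have hd2 : μ.real (openConn a₂ c : Set (BondConfig (Fin n)))ᶜ = T2 + S1 + J := by
    have := disconnection_split₃ w o c a₂ a₁
    have eJ : ((openConn o a₂ : Set (BondConfig (Fin n))) ∩ openConn o a₁ ∩ (openConn o c)ᶜ) =
        ((openConn o a₁ : Set (BondConfig (Fin n))) ∩ openConn o a₂ ∩ (openConn o c)ᶜ) := by
      ext ω; simp only [mem_inter_iff, mem_compl_iff]; tauto
    rw [eJ] at this
    exact this
  have hC : S1 * S2 ≤ T1 * T2 := worstPairExchange_two w o c a₁ a₂ h12
  have hT1 : 0 ≤ T1 := measureReal_nonneg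
  have hT2 : 0 ≤ T2 := measureReal_nonneg
  have hS1 : 0 ≤ S1 := measureReal_nonneg
  have hS2 : 0 ≤ S2 := measureReal_nonneg
  have hJ0 : 0 ≤ J := measureReal_nonneg
  -- event gluing at the worse relay: S1 ≤ T1
  have hEG : S1 ≤ T1 := by
    rcases le_or_le_of_mul_le_mul hT1 hT2 hC with h | h
    · exact h
    · -- T1 - S1 = (T2 - S2) + (d₁ - d₂) ≥ 0
      rw [hd1, hd2] at hd
      linarith
  rw [hd1, hd2]
  have hJ1 : J * S1 ≤ J * T1 := mul_le_mul_of_nonneg_left hEG hJ0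
  nlinarith [hC, hJ1, mul_nonneg hT1 hS1]

namespace WorstFirstGluing

variable {n : ℕ}

/-- The ordered pair case of (WF): if `a` is ranked worst in `{a, b}` (`d_b < d_a`, or `d_b = d_a` and `a ≤ b`),
then `μ(W_a)/d_a + μ(W_b)/d_b ≤ 1` in the schema's exact form. [this file] -/
theorem pair_case (w : Sym2 (Fin n) → unitInterval) (o c a b : Fin n) (hab : a ≠ b)
    (hrank : (prodBernoulli w).real (openConn b c : Set (BondConfig (Fin n)))ᶜ <
        (prodBernoulli w).real (openConn a c : Set (BondConfig (Fin n)))ᶜ ∨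
      ((prodBernoulli w).real (openConn b c : Set (BondConfig (Fin n)))ᶜ =
        (prodBernoulli w).real (openConn a c : Set (BondConfig (Fin n)))ᶜ ∧ a ≤ b)) :
    ∑ y ∈ ({a, b} : Finset (Fin n)), (prodBernoulli w).real
        {ω : BondConfig (Fin n) | (openGraph ω).Reachable o y ∧ ¬ (openGraph ω).Reachable o c ∧
          ∀ x ∈ ({a, b} : Finset (Fin n)), (openGraph ω).Reachable o x →
            ((prodBernoulli w).real (openConn x c : Set (BondConfig (Fin n)))ᶜ <
                (prodBernoulli w).real (openConn y c : Set (BondConfig (Fin n)))ᶜ ∨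
             ((prodBernoulli w).real (openConn x c : Set (BondConfig (Fin n)))ᶜ =
                (prodBernoulli w).real (openConn y c : Set (BondConfig (Fin n)))ᶜ ∧ y ≤ x))} /
      (prodBernoulli w).real (openConn y c : Set (BondConfig (Fin n)))ᶜ ≤ 1 := by
  set μ := prodBernoulli w with hμ
  set da := μ.real (openConn a c : Set (BondConfig (Fin n)))ᶜ with hda
  set db := μ.real (openConn b c : Set (BondConfig (Fin n)))ᶜ with hdb
  have hdba : db ≤ da := by rcases hrank with h | ⟨h, _⟩; exacts [h.le, h.le]
  -- the condition at x = a fails for y = b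
  have hnot : ¬ (da < db ∨ (da = db ∧ b ≤ a)) := by
    rintro (h | ⟨h, h'⟩)
    · exact absurd h (not_lt.2 hdba)
    · rcases hrank with h2 | ⟨_, h2'⟩
      · rw [h] at h2; exact lt_irrefl _ h2
      · exact hab (le_antisymm h2' h')
  rw [Finset.sum_pair hab]
  -- identify the two events
  have eWa : {ω : BondConfig (Fin n) | (openGraph ω).Reachable o a ∧ ¬ (openGraph ω).Reachable o c ∧
          ∀ x ∈ ({a, b} : Finset (Fin n)), (openGraph ω).Reachable o x →
            (μ.real (openConn x c : Set (BondConfig (Fin n)))ᶜ < da ∨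
             (μ.real (openConn x c : Set (BondConfig (Fin n)))ᶜ = da ∧ a ≤ x))} =
      ((openConn o a : Set (BondConfig (Fin n))) ∩ (openConn o c)ᶜ) := by
    ext ω
    simp only [mem_setOf_eq, mem_inter_iff, mem_compl_iff, Finset.mem_insert, Finset.mem_singleton, openConn]
    constructor
    · rintro ⟨hoa, hoc, _⟩; exact ⟨hoa, hoc⟩
    · rintro ⟨hoa, hoc⟩
      refine ⟨hoa, hoc, ?_⟩
      rintro x (rfl | rfl) _
      · exact Or.inr ⟨rfl, le_rfl⟩
      · exact hrank
  have eWb : {ω : BondConfig (Fin n) | (openGraph ω).Reachable o b ∧ ¬ (openGraph ω).Reachable o c ∧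
          ∀ x ∈ ({a, b} : Finset (Fin n)), (openGraph ω).Reachable o x →
            (μ.real (openConn x c : Set (BondConfig (Fin n)))ᶜ < db ∨
             (μ.real (openConn x c : Set (BondConfig (Fin n)))ᶜ = db ∧ b ≤ x))} =
      ((openConn o a : Set (BondConfig (Fin n)))ᶜ ∩ (openConn o c)ᶜ ∩ openConn o b) := by
    ext ω
    simp only [mem_setOf_eq, mem_inter_iff, mem_compl_iff, Finset.mem_insert, Finset.mem_singleton, openConn]
    constructor
    · rintro ⟨hob, hoc, hall⟩
      refine ⟨⟨fun hoa => hnot (hall a (Or.inl rfl) hoa), hoc⟩, hob⟩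
    · rintro ⟨⟨hoa, hoc⟩, hob⟩
      refine ⟨hob, hoc, ?_⟩
      rintro x (rfl | rfl) hox
      · exact absurd hox hoa
      · exact Or.inr ⟨rfl, le_rfl⟩
  rw [eWa, eWb]
  set T := μ.real ((openConn o a : Set (BondConfig (Fin n)))ᶜ ∩ (openConn a c)ᶜ) with hT
  set S := μ.real ((openConn o a : Set (BondConfig (Fin n)))ᶜ ∩ (openConn o c)ᶜ ∩ openConn o b) with hS
  have hkey : da * S ≤ db * T := worstFirst_two_mul w o c a b hab hdba
  -- μ(o ↔ a, o ↮ c) = da - T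
  have hWa : μ.real ((openConn o a : Set (BondConfig (Fin n))) ∩ (openConn o c)ᶜ) = da - T := by
    have h1 := WorstPairExchange.split_disconnection w o c a
    have hset : ((openConn o a : Set (BondConfig (Fin n))) ∩ (openConn a c)ᶜ) =
        ((openConn o a : Set (BondConfig (Fin n))) ∩ (openConn o c)ᶜ) := by
      ext ω
      simp only [mem_inter_iff, mem_compl_iff]
      constructor
      · rintro ⟨hoa, hac⟩
        exact ⟨hoa, fun hoc => hac (SimpleGraph.Reachable.trans (SimpleGraph.Reachable.symm hoa) hoc)⟩
      · rintro ⟨hoa, hoc⟩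
        exact ⟨hoa, fun hac => hoc (SimpleGraph.Reachable.trans hoa hac)⟩
    rw [hset] at h1
    linarith
  rw [hWa]
  show (da - T) / da + S / db ≤ 1
  have hT0 : 0 ≤ T := measureReal_nonneg
  have hS0 : 0 ≤ S := measureReal_nonneg
  have hTle : T ≤ da := by
    have : 0 ≤ μ.real ((openConn o a : Set (BondConfig (Fin n))) ∩ (openConn o c)ᶜ) := measureReal_nonneg
    linarith
  rcases eq_or_lt_of_le (show 0 ≤ da from measureReal_nonneg) with hda0 | hdapos
  · -- da = 0, hence db = 0: both terms vanish
    have hdb0 : db = 0 := le_antisymm (by rw [hda0]; exact hdba) measureReal_nonneg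
    rw [← hda0, hdb0]; simp
  rcases eq_or_lt_of_le (show 0 ≤ db from measureReal_nonneg) with hdb0 | hdbpos
  · -- db = 0: S = 0
    have h0 : da * S ≤ da * 0 := by
      calc da * S ≤ db * T := hkey
        _ = da * 0 := by rw [← hdb0, zero_mul, mul_zero]
    have hSle : S ≤ 0 := le_of_mul_le_mul_left h0 hdapos
    have hS' : S = 0 := le_antisymm hSle hS0
    rw [hS', ← hdb0]
    simp only [div_zero, add_zero]
    rw [div_le_one hdapos]
    linarith
  · have h1 : S / db ≤ T / da := by
      rw [div_le_div_iff₀ hdbpos hdapos]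
      linarith [hkey, mul_comm da S, mul_comm db T]
    have h2 : (da - T) / da + T / da = 1 := by
      field_simp
      ring
    linarith

end WorstFirstGluing

/-- **(WF) holds for every relay set with at most two relays**, in the exact form of the hypothesis of
`eventGluing_of_worstFirst`. [this file] -/
theorem worstFirst_card_le_two {n : ℕ} (w : Sym2 (Fin n) → unitInterval) (A : Finset (Fin n)) (o c : Fin n)
    (hA : A.card ≤ 2) :
    ∑ a ∈ A, (prodBernoulli w).real
        {ω : BondConfig (Fin n) | (openGraph ω).Reachable o a ∧ ¬ (openGraph ω).Reachable o c ∧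
          ∀ x ∈ A, (openGraph ω).Reachable o x →
            ((prodBernoulli w).real (openConn x c : Set (BondConfig (Fin n)))ᶜ <
                (prodBernoulli w).real (openConn a c : Set (BondConfig (Fin n)))ᶜ ∨
             ((prodBernoulli w).real (openConn x c : Set (BondConfig (Fin n)))ᶜ =
                (prodBernoulli w).real (openConn a c : Set (BondConfig (Fin n)))ᶜ ∧ a ≤ x))} /
      (prodBernoulli w).real (openConn a c : Set (BondConfig (Fin n)))ᶜ ≤ 1 := by
  set μ := prodBernoulli w with hμ
  rcases A.eq_empty_or_nonempty with hAe | ⟨a, haA⟩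
  · subst hAe; simp
  rcases (A.erase a).eq_empty_or_nonempty with hE | ⟨b, hbE⟩
  · -- A = {a}
    have hAeq : A = {a} := by
      ext x
      constructor
      · intro hx
        by_contra hxa
        have : x ∈ A.erase a := Finset.mem_erase.2 ⟨fun h => hxa (by rw [h]; exact Finset.mem_singleton_self a), hx⟩
        rw [hE] at this; exact absurd this (Finset.notMem_empty x)
      · intro hx; rw [Finset.mem_singleton.1 hx]; exact haA
    subst hAeq
    rw [Finset.sum_singleton]
    have hsub := rank_event_subset ({a} : Finset (Fin n)) o c a
      (fun x => μ.real (openConn x c : Set (BondConfig (Fin n)))ᶜ)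
    have hle := measureReal_mono (μ := μ) hsub
    rcases eq_or_lt_of_le (measureReal_nonneg : 0 ≤ μ.real (openConn a c : Set (BondConfig (Fin n)))ᶜ) with h0 | hpos
    · rw [← h0]; simp
    · exact (div_le_one hpos).2 hle
  · -- A = {a, b}
    have hba : b ≠ a := (Finset.mem_erase.1 hbE).1
    have hbA : b ∈ A := Finset.mem_of_mem_erase hbE
    have hAeq : ({a, b} : Finset (Fin n)) = A := by
      apply Finset.eq_of_subset_of_card_le
      · intro x hx
        rcases Finset.mem_insert.1 hx with rfl | hx'
        · exact haA
        · rw [Finset.mem_singleton.1 hx']; exact hbA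
      · rw [Finset.card_pair hba.symm]; exact hA
    rw [← hAeq]
    by_cases hrank : μ.real (openConn b c : Set (BondConfig (Fin n)))ᶜ <
        μ.real (openConn a c : Set (BondConfig (Fin n)))ᶜ ∨
      (μ.real (openConn b c : Set (BondConfig (Fin n)))ᶜ =
        μ.real (openConn a c : Set (BondConfig (Fin n)))ᶜ ∧ a ≤ b)
    · exact WorstFirstGluing.pair_case w o c a b hba.symm hrank
    · have hrank' : μ.real (openConn a c : Set (BondConfig (Fin n)))ᶜ <
          μ.real (openConn b c : Set (BondConfig (Fin n)))ᶜ ∨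
        (μ.real (openConn a c : Set (BondConfig (Fin n)))ᶜ =
          μ.real (openConn b c : Set (BondConfig (Fin n)))ᶜ ∧ b ≤ a) := by
        push Not at hrank
        rcases lt_or_eq_of_le hrank.1 with h | h
        · exact Or.inl h
        · exact Or.inr ⟨h, (hrank.2 h.symm).le⟩
      rw [Finset.pair_comm]
      exact WorstFirstGluing.pair_case w o c b a hba hrank'

end Summit.CriticalPhenomena.PercolationContinuityZ3.Theorems

end
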